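import Literature.MathematicalPhysics.QuantumFieldTheory.Balaban1983to89.B1Eq324BenfattoKernelComparisonBounded
import Literature.MathematicalPhysics.QuantumFieldTheory.Balaban1983to89.B1Eq324BenfattoKernelSect5Eq513
import Literature.MathematicalPhysics.QuantumFieldTheory.Balaban1983to89.B1Eq324BenfattoSect5Iteration
import Literature.LinearAlgebra.Matrix.MinkowskiDet
import HarnessLib

/-!
# `Balaban1983to89.B1Eq324BenfattoKernelComparisonTwoMembers` — [BenfattoEtAl1978] (4.6)–(4.7) p. 152 for the class of
# [Balaban1985BackgroundPropagators] Sect. E p. 428: TWO MEMBERS ON THE SAME WINDOW whose precisions differ by a matrix with small absolute row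
# sums have two-sidedly comparable cut-off exponential moments — `e^{−E}·Z₁ ≤ Z₂ ≤ e^{E}·Z₁` with an explicit `E` — PROVED

statement-level skeleton of published theorems with citation tags; proofs where landed; nothing here is a claim about the
Yang–Mills mass gap

WHY THIS MODULE (cell `pub-ymgap`, width seat `dag-n08-w5` gen 3; node N08 [Balaban1985UV3]; the [BenfattoEtAl1978] source chain behind the
(α)-row `h324`).  The class road proves the Lemma of p. 152 for the Gaussian field `𝒩(0,K)` of a class member `(Λ, A, K)` (`K = A⁻¹` zero-extended
off the finite window `Λ ⊂ ℤ^d`; seat n08-c's `…KernelSect5ClassBasicLemma.classBasicLemma_signed`).  An instantiation may hold only an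
APPROXIMATE member (seat n08-d's located CHECK C, out (T2) «comparison by images»: a covariance that no member hosts, but whose precision is
row-wise close to a member's); seat n08-w4's `Summits/…/BalabanUVNodesN08AlphaEq324RowClassSocketApprox` consumes the (3.24) row through a
two-sided transfer `e^{−E}·Z ≤ Z′ ≤ e^{E}·Z`.  This file supplies that transfer for the INTEGRAL: if `(Λ, A₁, K₁)`, `(Λ, A₂, K₂)` are zero-extended
inverses on one window with `A₁` symmetric `γ`-coercive, `A₂` symmetric and `Σ_{e′}|A₂ e e′ − A₁ e e′| ≤ r_e ≤ r_max < γ`, then every measurable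
`F ≥ 0` supported in a coordinate box `{|z_e| ≤ B_e, e ∈ Λ}` — the integrand `Π_Δχ̂_Δ e^{H_J}` of (4.6)–(4.7) is one, `B_e = b(1 + d(I, Δ_e))` — has
`e^{−E}∫F d𝒩(0,K₁) ≤ ∫F d𝒩(0,K₂) ≤ e^{E}∫F d𝒩(0,K₁)`, `E = Σ_e r_e/(2(γ − r_max)) + ½Σ_e r_e B_e²` (normalisation ratio + form difference on the
support).  No class row is asked of `A₂`.  The cumulant half (`cumulantSum 𝒩(0,K₂) H t` vs `cumulantSum 𝒩(0,K₁) H t`) is NOT treated here.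

HOW.  §1 (any finite index type): Schur bound `|⟨x,(A₂−A₁)x⟩| ≤ Σ_e r_e x_e²`; `A₂` is `(γ − r_max)`-coercive; `det A₂ ≤ det A₁·e^{Σr/γ}` (Minkowski
monotonicity `det A₂ ≤ det(A₁ + diag r)`, the tree's `Literature.LinearAlgebra.Matrix.det_le_det_add_of_posSemidef`, then seat n08-b's
`…ClassDecouplingExtensive.det_add_diag_le_det_mul_exp`), so `Z_{A₂}⁻¹Z_{A₁} = √(det A₂/det A₁) ∈ [e^{−ρ/2}, e^{ρ/2}]`, `ρ = Σ_e r_e/(γ − r_max)`; and the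
covariance-side door `G₂⁻¹ − G₁⁻¹ = G₂⁻¹(G₁ − G₂)G₁⁻¹`.  §2 feeds §1 into seat n08-d's restricted-support sandwich
`…KernelComparisonBounded.lintegral_multivariateGaussian_le/ge_of_form_sub_le_on`.  §3 transports §2 to the fields on `ℝ^{ℤ^d}` (window law
`…KernelComparison.lintegral_comp_restrict_eq`, Gram identity `…KernelComparisonBoxes.covGram_kernel_eq_inv`, off-window coordinates a.s. zero
`…KernelSect5Eq513.ae_eq_zero_of_not_mem`).  §4: Bochner currency, the class integrand `cutoffBoltzmann (hamiltonian …) I b`, the factor form.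

WHAT IS PROVED (theorems only; no definition, no named fact, no `sorry`; axioms standard).
* §1 `abs_form_le_diag_of_rows`, `coercive_of_rows`, `det_le_det_mul_exp_of_rows`, ★ `sqrt_det_ratio_le_exp_of_rows`, `gaussZ_ratio_bounds_of_rows`,
  `rowSum_mul_le`, ★ `rows_inv_sub_inv_le` (row sums of `G₂⁻¹ − G₁⁻¹` from row sums of `G₂ − G₁`, `G₁⁻¹`, `G₂⁻¹`).
* §2 ★ `lintegral_multivariateGaussian_bounds_of_rows_on` (two precisions, support `Σ_e r_e y_e² ≤ T`: factor `e^{±(ρ/2 + T/2)}`).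
* §3 `lintegral_eq_lintegral_window`, ★★ `lintegral_bounds_of_rows` (two zero-extended members on one window; support in a coordinate box on `Λ`).
* §4 ★★ `integral_bounds_of_rows` (real observables), ★★★ `integral_cutoffBoltzmann_bounds_of_rows`
  (`e^{−E}·∫Πχ̂e^{H_J}d𝒩(0,K₁) ≤ ∫Πχ̂e^{H_J}d𝒩(0,K₂) ≤ e^{E}·∫Πχ̂e^{H_J}d𝒩(0,K₁)`, `E = Σ_e r_e/(2(γ − r_max)) + ½Σ_{e∈Λ} r_e(b(1 + d(I,Δ_e)))²`;
  every `s, D, ϰ, 𝔄, J, I, b`), `exists_factor_integral_cutoffBoltzmann_of_rows` (`Z₂ = Z₁·w`, `w ∈ [e^{−E}, e^{E}]`).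
* §5 (v1.1, appended) TWO COERCIVITIES — `A₂` `γ₂`-coercive on its own replaces `r_e ≤ r_max < γ` (so `r_e` may be of order one where it lives, e.g. on a
  seam): `det_le_det_mul_exp_of_rows₂`, `sqrt_det_ratio_le_exp_of_rows₂`, `gaussZ_ratio_bounds_of_rows₂`, `lintegral_multivariateGaussian_bounds_of_rows_on₂`,
  `lintegral_bounds_of_rows₂` (one-sided exponents `Σr/(2γ₁) + T/2`, `Σr/(2γ₂) + T/2`), `integral_bounds_of_rows₂`, ★★★ `integral_cutoffBoltzmann_bounds_of_rows₂`,
  `exists_factor_integral_cutoffBoltzmann_of_rows₂` (common `E = Σr/(2γ₁) + Σr/(2γ₂) + (b²/2)Σ_e r_e(1 + d(I,Δ_e))²`).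

HONEST SCOPE / NOT HERE.  [folklore] Gaussian and matrix bookkeeping for OUR class form; which approximate member an instantiation uses (torus
images or anything else) is NODE 00's choice and is neither decided nor constructed here; nothing about the covariance of [Balaban1985UV3]'s (58), its
decay or its period; the cumulant discrepancy is not treated; nothing of [Balaban1985UV3] / [Balaban1985UV2] is asserted; N08 is NOT discharged by this
file; count-neutral; nothing about d = 4, the continuum, OS axioms, a mass gap or the Clay problem.
-/

noncomputable section

open MeasureTheory ProbabilityTheory Finset Matrix WithLp
open scoped BigOperators Matrix NNReal ENNReal

namespace Literature.MathematicalPhysics.QuantumFieldTheory.Balaban1983to89.B1Eq324BenfattoKernelComparisonTwoMembers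

open Literature.MathematicalPhysics.QuantumFieldTheory
open Literature.MathematicalPhysics.QuantumFieldTheory.GaussianToolkit
open Literature.MathematicalPhysics.QuantumFieldTheory.Balaban1983to89.B1Eq324BenfattoLemma
open Literature.MathematicalPhysics.QuantumFieldTheory.Balaban1983to89.B1Eq324BenfattoKernelOfPrecision
open Literature.MathematicalPhysics.QuantumFieldTheory.Balaban1983to89.B1Eq324BenfattoKernelComparison
open Literature.MathematicalPhysics.QuantumFieldTheory.Balaban1983to89.B1Eq324BenfattoKernelComparisonBoxes
open Literature.MathematicalPhysics.QuantumFieldTheory.Balaban1983to89.B1Eq324BenfattoKernelComparisonBounded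
open Literature.MathematicalPhysics.QuantumFieldTheory.Balaban1983to89.B1Eq324BenfattoClassAppendixC
open Literature.MathematicalPhysics.QuantumFieldTheory.Balaban1983to89.B1Eq324BenfattoClassDecouplingExtensive
open Literature.MathematicalPhysics.QuantumFieldTheory.Balaban1983to89.B1Eq324BenfattoKernelSect5Eq513 (ae_eq_zero_of_not_mem)
open Literature.MathematicalPhysics.QuantumFieldTheory.Balaban1983to89.B1Eq324BenfattoSect5Iteration (measurable_cutoffBoltzmann_hamiltonian)

variable {d : ℕ}

/-! ## §1  The matrix part: Schur bound for the difference, coercivity of the second member, determinant ratio -/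

section MatrixPart

variable {m : Type*} [Fintype m] [DecidableEq m]

omit [DecidableEq m] in
/-- The quadratic form in double-sum currency. [cite: HornJohnson2013, §0.7.2] -/
private theorem dot_form_eq (B : Matrix m m ℝ) (x : m → ℝ) :
    x ⬝ᵥ B *ᵥ x = ∑ y, ∑ y', B y y' * x y * x y' := by
  simp only [dotProduct, Matrix.mulVec, Finset.mul_sum]
  exact Finset.sum_congr rfl fun y _ => Finset.sum_congr rfl fun y' _ => by ring

omit [DecidableEq m] in
/-- Absolute row sums are non-negative bounds. [folklore] -/
private theorem r_nonneg {D : Matrix m m ℝ} {r : m → ℝ} (hr : ∀ y, ∑ y', |D y y'| ≤ r y) (y : m) : 0 ≤ r y :=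
  le_trans (Finset.sum_nonneg fun _ _ => abs_nonneg _) (hr y)

omit [DecidableEq m] in
/-- **Position-dependent Schur bound for a symmetric matrix**: `Σ_{e′}|D e e′| ≤ r_e` for every row gives `|⟨x,Dx⟩| ≤ Σ_e r_e x_e²`
(AM–GM on each entry, the column sums equal the row sums). [cite: HornJohnson2013, §5.6 (Schur test; row-sum bound), position-dependent form] -/
theorem abs_form_le_diag_of_rows {D : Matrix m m ℝ} (hD : ∀ y y', D y y' = D y' y) (r : m → ℝ)
    (hr : ∀ y, ∑ y', |D y y'| ≤ r y) (x : m → ℝ) :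
    |∑ y, ∑ y', D y y' * x y * x y'| ≤ ∑ y, r y * x y ^ 2 := by
  have hterm : ∀ y y', |D y y' * x y * x y'| ≤ |D y y'| * ((x y ^ 2 + x y' ^ 2) / 2) := by
    intro y y'
    rw [abs_mul, abs_mul]
    have hamgm : |x y| * |x y'| ≤ (x y ^ 2 + x y' ^ 2) / 2 := by
      nlinarith [sq_nonneg (|x y| - |x y'|), sq_abs (x y), sq_abs (x y')]
    calc |D y y'| * |x y| * |x y'| = |D y y'| * (|x y| * |x y'|) := by ring
      _ ≤ |D y y'| * ((x y ^ 2 + x y' ^ 2) / 2) := mul_le_mul_of_nonneg_left hamgm (abs_nonneg _)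
  have hA1 : ∑ y, ∑ y', |D y y'| * x y ^ 2 ≤ ∑ y, r y * x y ^ 2 := by
    refine Finset.sum_le_sum fun y _ => ?_
    rw [← Finset.sum_mul]
    exact mul_le_mul_of_nonneg_right (hr y) (sq_nonneg _)
  have hA2 : ∑ y, ∑ y', |D y y'| * x y' ^ 2 ≤ ∑ y, r y * x y ^ 2 := by
    rw [Finset.sum_comm]
    refine Finset.sum_le_sum fun y' _ => ?_
    rw [← Finset.sum_mul]
    refine mul_le_mul_of_nonneg_right ?_ (sq_nonneg _)
    calc ∑ y, |D y y'| = ∑ y, |D y' y| := Finset.sum_congr rfl fun y _ => by rw [hD y y']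
      _ ≤ r y' := hr y'
  have hsum : ∑ y, ∑ y', |D y y'| * ((x y ^ 2 + x y' ^ 2) / 2)
      = ((∑ y, ∑ y', |D y y'| * x y ^ 2) + ∑ y, ∑ y', |D y y'| * x y' ^ 2) / 2 := by
    rw [← Finset.sum_add_distrib, Finset.sum_div]
    refine Finset.sum_congr rfl fun y _ => ?_
    rw [← Finset.sum_add_distrib, Finset.sum_div]
    refine Finset.sum_congr rfl fun y' _ => ?_
    ring
  calc |∑ y, ∑ y', D y y' * x y * x y'|
      ≤ ∑ y, |∑ y', D y y' * x y * x y'| := Finset.abs_sum_le_sum_abs _ _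
    _ ≤ ∑ y, ∑ y', |D y y' * x y * x y'| := Finset.sum_le_sum fun y _ => Finset.abs_sum_le_sum_abs _ _
    _ ≤ ∑ y, ∑ y', |D y y'| * ((x y ^ 2 + x y' ^ 2) / 2) :=
        Finset.sum_le_sum fun y _ => Finset.sum_le_sum fun y' _ => hterm y y'
    _ ≤ ∑ y, r y * x y ^ 2 := by rw [hsum]; linarith

omit [DecidableEq m] in
/-- The form of `A₂` splits as the form of `A₁` plus the form of the difference. [folklore] -/
private theorem form_split (A₁ A₂ : Matrix m m ℝ) (x : m → ℝ) :
    ∑ y, ∑ y', A₂ y y' * x y * x y' = (∑ y, ∑ y', A₁ y y' * x y * x y') + ∑ y, ∑ y', (A₂ y y' - A₁ y y') * x y * x y' := by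
  rw [← Finset.sum_add_distrib]
  refine Finset.sum_congr rfl fun y _ => ?_
  rw [← Finset.sum_add_distrib]
  exact Finset.sum_congr rfl fun y' _ => by ring

omit [DecidableEq m] in
/-- **The second member stays coercive**: if `A₁` is `γ`-coercive and the rows of `A₂ − A₁` are absolutely summable by `r_e ≤ r_max`, then `A₂` is
`(γ − r_max)`-coercive. [cite: HornJohnson2013, Thm 4.3.1 (Weyl: a perturbation shifts the bottom of the spectrum by at most its norm) with §5.6] -/
theorem coercive_of_rows {A₁ A₂ : Matrix m m ℝ} (hA₁ : ∀ y y', A₁ y y' = A₁ y' y) (hA₂ : ∀ y y', A₂ y y' = A₂ y' y)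
    {γ rmax : ℝ} (r : m → ℝ) (hγ : ∀ x : m → ℝ, γ * ∑ y, x y ^ 2 ≤ ∑ y, ∑ y', A₁ y y' * x y * x y')
    (hr : ∀ y, ∑ y', |A₂ y y' - A₁ y y'| ≤ r y) (hrmax : ∀ y, r y ≤ rmax) (x : m → ℝ) :
    (γ - rmax) * ∑ y, x y ^ 2 ≤ ∑ y, ∑ y', A₂ y y' * x y * x y' := by
  have hDs : ∀ y y', (A₂ y y' - A₁ y y') = (A₂ y' y - A₁ y' y) := fun y y' => by rw [hA₁ y y', hA₂ y y']
  have hD := abs_form_le_diag_of_rows (D := fun y y' => A₂ y y' - A₁ y y') hDs r hr x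
  have h1 := hγ x
  have h2 : ∑ y, r y * x y ^ 2 ≤ rmax * ∑ y, x y ^ 2 := by
    rw [Finset.mul_sum]
    exact Finset.sum_le_sum fun y _ => mul_le_mul_of_nonneg_right (hrmax y) (sq_nonneg _)
  have h3 := neg_abs_le (∑ y, ∑ y', (A₂ y y' - A₁ y y') * x y * x y')
  rw [form_split A₁ A₂ x]
  nlinarith

/-- kernel: one-sided determinant bound — `A₁` symmetric `γ`-coercive (`γ > 0`), `A₂` positive semidefinite with `Σ_{e′}|A₂ e e′ − A₁ e e′| ≤ r_e`,
then `det A₂ ≤ det A₁·e^{Σ_e r_e/γ}`: Minkowski monotonicity `det A₂ ≤ det(A₁ + diag r)` (`A₁ + diag r − A₂ ⪰ 0` by the Schur bound) and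
`det(A₁ + diag r) ≤ det A₁·e^{Σr/γ}`. [cite: HornJohnson2013, Cor. 7.7.4 (determinant monotone in the Loewner order), §0.8.5 with §7.1] -/
private theorem det_le_det_mul_exp_core {A₁ A₂ : Matrix m m ℝ} (hA₁ : ∀ y y', A₁ y y' = A₁ y' y) (hA₂ : ∀ y y', A₂ y y' = A₂ y' y)
    {γ : ℝ} (hγ0 : 0 < γ) (r : m → ℝ) (hγ : ∀ x : m → ℝ, γ * ∑ y, x y ^ 2 ≤ ∑ y, ∑ y', A₁ y y' * x y * x y')
    (hA₂psd : A₂.PosSemidef) (hr : ∀ y, ∑ y', |A₂ y y' - A₁ y y'| ≤ r y) :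
    A₂.det ≤ A₁.det * Real.exp ((∑ y, r y) / γ) := by
  have hr0 : ∀ y, 0 ≤ r y := r_nonneg hr
  have hDs : ∀ y y', (A₂ y y' - A₁ y y') = (A₂ y' y - A₁ y' y) := fun y y' => by rw [hA₁ y y', hA₂ y y']
  -- `Q := A₁ + diag r − A₂ ⪰ 0`
  set Q : Matrix m m ℝ := A₁ + Matrix.diagonal r - A₂ with hQ
  have hQs : ∀ i j, Q i j = Q j i := by
    intro i j
    simp only [hQ, Matrix.sub_apply, Matrix.add_apply]
    rw [hA₁ i j, hA₂ i j]
    by_cases h : i = j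
    · subst h; rfl
    · rw [Matrix.diagonal_apply_ne _ h, Matrix.diagonal_apply_ne _ (Ne.symm h)]
  have hQform : ∀ x : m → ℝ, x ⬝ᵥ Q *ᵥ x =
      (∑ y, ∑ y', A₁ y y' * x y * x y') + (∑ y, r y * x y ^ 2) - ∑ y, ∑ y', A₂ y y' * x y * x y' := by
    intro x
    have hd : x ⬝ᵥ Matrix.diagonal r *ᵥ x = ∑ y, r y * x y ^ 2 := by
      simp only [dotProduct, Matrix.mulVec_diagonal]
      exact Finset.sum_congr rfl fun y _ => by ring
    rw [hQ, Matrix.sub_mulVec, Matrix.add_mulVec, dotProduct_sub, dotProduct_add, dot_form_eq A₁ x, dot_form_eq A₂ x, hd]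
  have hQpsd : Q.PosSemidef := by
    refine Matrix.PosSemidef.of_dotProduct_mulVec_nonneg (Matrix.IsHermitian.ext fun i j => by simpa using hQs j i) fun x => ?_
    simp only [star_trivial]
    rw [hQform, form_split A₁ A₂ x]
    have h := le_abs_self (∑ y, ∑ y', (A₂ y y' - A₁ y y') * x y * x y')
    have hD := abs_form_le_diag_of_rows (D := fun y y' => A₂ y y' - A₁ y y') hDs r hr x
    linarith
  -- Minkowski monotonicity
  have h1 : A₂.det ≤ (A₁ + Matrix.diagonal r).det := by
    have h := Literature.LinearAlgebra.Matrix.det_le_det_add_of_posSemidef hA₂psd hQpsd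
    have hsum : A₂ + Q = A₁ + Matrix.diagonal r := by rw [hQ]; abel
    rwa [hsum] at h
  -- the diagonal enlargement
  have h2 : (A₁ + Matrix.diagonal r).det ≤ A₁.det * Real.exp ((∑ y, r y) / γ) := by
    have h := det_add_diag_le_det_mul_exp hA₁ hγ0 hγ (fun y => r y / 2) (fun y => by linarith [hr0 y])
    have hdiag : (Matrix.diagonal fun y => 2 * (r y / 2)) = Matrix.diagonal r := by
      congr 1; funext y; ring
    have hexp : 2 * ∑ y, r y / 2 / γ = (∑ y, r y) / γ := by
      rw [Finset.sum_div, Finset.mul_sum]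
      exact Finset.sum_congr rfl fun y _ => by ring
    rw [hdiag, hexp] at h
    exact h
  exact h1.trans h2

/-- **DETERMINANT RATIO OF TWO MEMBERS**: with `A₁` symmetric `γ`-coercive, `A₂` symmetric, `Σ_{e′}|A₂ e e′ − A₁ e e′| ≤ r_e ≤ r_max < γ` and
`ρ := Σ_e r_e/(γ − r_max)`: `det A₂ ≤ det A₁·e^{ρ}` and `det A₁ ≤ det A₂·e^{ρ}` (both members positive definite).
[cite: HornJohnson2013, Cor. 7.7.4, §0.8.5 with §7.1; BenfattoEtAl1978, (5.13) p.155 (class substitute; ours)] -/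
theorem det_le_det_mul_exp_of_rows {A₁ A₂ : Matrix m m ℝ} (hA₁ : ∀ y y', A₁ y y' = A₁ y' y) (hA₂ : ∀ y y', A₂ y y' = A₂ y' y)
    {γ rmax : ℝ} (r : m → ℝ) (hγ : ∀ x : m → ℝ, γ * ∑ y, x y ^ 2 ≤ ∑ y, ∑ y', A₁ y y' * x y * x y')
    (hr : ∀ y, ∑ y', |A₂ y y' - A₁ y y'| ≤ r y) (hrmax : ∀ y, r y ≤ rmax) (hγr : rmax < γ) :
    A₂.det ≤ A₁.det * Real.exp ((∑ y, r y) / (γ - rmax)) ∧ A₁.det ≤ A₂.det * Real.exp ((∑ y, r y) / (γ - rmax)) := by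
  have hr0 : ∀ y, 0 ≤ r y := r_nonneg hr
  have hγ' : 0 < γ - rmax := by linarith
  rcases isEmpty_or_nonempty m with hm | hm
  · haveI := hm
    have h1 : A₁.det = 1 := Matrix.det_isEmpty
    have h2 : A₂.det = 1 := Matrix.det_isEmpty
    have hs : ∑ y, r y = 0 := by simp [Finset.univ_eq_empty]
    rw [h1, h2, hs, zero_div, Real.exp_zero, mul_one]
    exact ⟨le_rfl, le_rfl⟩
  obtain ⟨y₀⟩ := hm
  have hrmax0 : 0 ≤ rmax := (hr0 y₀).trans (hrmax y₀)
  have hγ0 : 0 < γ := by linarith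
  have hγ2 : ∀ x : m → ℝ, (γ - rmax) * ∑ y, x y ^ 2 ≤ ∑ y, ∑ y', A₂ y y' * x y * x y' := coercive_of_rows hA₁ hA₂ r hγ hr hrmax
  have hA₁pd : A₁.PosDef := posDef_of_coercive hA₁ hγ0 hγ
  have hA₂pd : A₂.PosDef := posDef_of_coercive hA₂ hγ' hγ2
  have hr' : ∀ y, ∑ y', |A₁ y y' - A₂ y y'| ≤ r y := fun y => by
    simpa only [abs_sub_comm] using hr y
  have hS0 : 0 ≤ ∑ y, r y := Finset.sum_nonneg fun y _ => hr0 y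
  constructor
  · have h := det_le_det_mul_exp_core hA₁ hA₂ hγ0 r hγ hA₂pd.posSemidef hr
    refine h.trans (mul_le_mul_of_nonneg_left (Real.exp_le_exp.2 ?_) hA₁pd.det_pos.le)
    exact div_le_div_of_nonneg_left hS0 hγ' (by linarith)
  · exact det_le_det_mul_exp_core hA₂ hA₁ hγ' r hγ2 hA₁pd.posSemidef hr'

/-- ★ **THE SQUARE-ROOT DETERMINANT RATIOS**: under the same hypotheses, `√(det A₂/det A₁) ≤ e^{ρ/2}` and `√(det A₁/det A₂) ≤ e^{ρ/2}`,
`ρ = Σ_e r_e/(γ − r_max)`. [cite: HornJohnson2013, Cor. 7.7.4 with §7.1; BenfattoEtAl1978, (5.13) p.155 (class substitute; ours)] -/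
theorem sqrt_det_ratio_le_exp_of_rows {A₁ A₂ : Matrix m m ℝ} (hA₁ : ∀ y y', A₁ y y' = A₁ y' y) (hA₂ : ∀ y y', A₂ y y' = A₂ y' y)
    {γ rmax : ℝ} (r : m → ℝ) (hγ : ∀ x : m → ℝ, γ * ∑ y, x y ^ 2 ≤ ∑ y, ∑ y', A₁ y y' * x y * x y')
    (hr : ∀ y, ∑ y', |A₂ y y' - A₁ y y'| ≤ r y) (hrmax : ∀ y, r y ≤ rmax) (hγr : rmax < γ) :
    Real.sqrt (A₂.det / A₁.det) ≤ Real.exp ((∑ y, r y) / (γ - rmax) / 2) ∧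
      Real.sqrt (A₁.det / A₂.det) ≤ Real.exp ((∑ y, r y) / (γ - rmax) / 2) := by
  obtain ⟨h12, h21⟩ := det_le_det_mul_exp_of_rows hA₁ hA₂ r hγ hr hrmax hγr
  have hr0 : ∀ y, 0 ≤ r y := r_nonneg hr
  have hγ' : 0 < γ - rmax := by linarith
  -- both determinants are positive
  have hdet : 0 < A₁.det ∧ 0 < A₂.det := by
    rcases isEmpty_or_nonempty m with hm | hm
    · haveI := hm
      rw [show A₁.det = 1 from Matrix.det_isEmpty, show A₂.det = 1 from Matrix.det_isEmpty]
      exact ⟨one_pos, one_pos⟩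
    obtain ⟨y₀⟩ := hm
    have hγ0 : 0 < γ := by linarith [(hr0 y₀).trans (hrmax y₀)]
    exact ⟨(posDef_of_coercive hA₁ hγ0 hγ).det_pos,
      (posDef_of_coercive hA₂ hγ' (coercive_of_rows hA₁ hA₂ r hγ hr hrmax)).det_pos⟩
  have hsq : Real.exp ((∑ y, r y) / (γ - rmax) / 2) ^ 2 = Real.exp ((∑ y, r y) / (γ - rmax)) := by
    rw [← Real.exp_nat_mul]; congr 1; ring
  constructor
  · refine Real.sqrt_le_iff.mpr ⟨(Real.exp_pos _).le, ?_⟩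
    rw [hsq, div_le_iff₀ hdet.1]
    linarith
  · refine Real.sqrt_le_iff.mpr ⟨(Real.exp_pos _).le, ?_⟩
    rw [hsq, div_le_iff₀ hdet.2]
    linarith

/-- **The normalisation ratio of the two Gaussians**: `Z_{A₂}⁻¹·Z_{A₁} = √(det A₂/det A₁)` lies in `[e^{−ρ/2}, e^{ρ/2}]`
(`…ClassDecouplingExtensive.gaussZ_inv_mul_gaussZ_eq`). [cite: HornJohnson2013, §7.1 (the Gaussian integral of a positive definite form), Cor. 7.7.4] -/
theorem gaussZ_ratio_bounds_of_rows {A₁ A₂ : Matrix m m ℝ} (hA₁ : ∀ y y', A₁ y y' = A₁ y' y) (hA₂ : ∀ y y', A₂ y y' = A₂ y' y)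
    {γ rmax : ℝ} (hγ0 : 0 < γ) (r : m → ℝ) (hγ : ∀ x : m → ℝ, γ * ∑ y, x y ^ 2 ≤ ∑ y, ∑ y', A₁ y y' * x y * x y')
    (hr : ∀ y, ∑ y', |A₂ y y' - A₁ y y'| ≤ r y) (hrmax : ∀ y, r y ≤ rmax) (hγr : rmax < γ) :
    (gaussZ A₂)⁻¹ * gaussZ A₁ ≤ ENNReal.ofReal (Real.exp ((∑ y, r y) / (γ - rmax) / 2)) ∧
      ENNReal.ofReal (Real.exp (-((∑ y, r y) / (γ - rmax) / 2))) ≤ (gaussZ A₂)⁻¹ * gaussZ A₁ := by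
  have hγ' : 0 < γ - rmax := by linarith
  have hA₁pd : A₁.PosDef := posDef_of_coercive hA₁ hγ0 hγ
  have hA₂pd : A₂.PosDef := posDef_of_coercive hA₂ hγ' (coercive_of_rows hA₁ hA₂ r hγ hr hrmax)
  obtain ⟨h12, h21⟩ := sqrt_det_ratio_le_exp_of_rows hA₁ hA₂ r hγ hr hrmax hγr
  rw [gaussZ_inv_mul_gaussZ_eq hA₁pd hA₂pd]
  refine ⟨ENNReal.ofReal_le_ofReal h12, ENNReal.ofReal_le_ofReal ?_⟩
  -- `e^{−ρ/2} ≤ √(det A₂/det A₁)` from `√(det A₁/det A₂) ≤ e^{ρ/2}`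
  have hd1 : 0 < A₁.det := hA₁pd.det_pos
  have hd2 : 0 < A₂.det := hA₂pd.det_pos
  have hs : Real.sqrt (A₁.det / A₂.det) * Real.sqrt (A₂.det / A₁.det) = 1 := by
    rw [← Real.sqrt_mul (div_pos hd1 hd2).le, div_mul_div_comm, mul_comm A₁.det, div_self (mul_pos hd2 hd1).ne', Real.sqrt_one]
  have hpos : 0 < Real.sqrt (A₂.det / A₁.det) := Real.sqrt_pos.2 (div_pos hd2 hd1)
  rw [Real.exp_neg]
  rw [inv_le_comm₀ (Real.exp_pos _) hpos]
  calc (Real.sqrt (A₂.det / A₁.det))⁻¹ = Real.sqrt (A₁.det / A₂.det) := by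
        rw [eq_comm, ← mul_eq_one_iff_eq_inv₀ hpos.ne']
        exact hs
    _ ≤ Real.exp ((∑ y, r y) / (γ - rmax) / 2) := h21

omit [DecidableEq m] in
/-- Row sums of a product: `Σ_j|(XY)_{ij}| ≤ (Σ_k|X_{ik}|)·b` when every row of `Y` has absolute sum `≤ b`. [cite: HornJohnson2013, §5.6 (the maximum row sum norm is submultiplicative)] -/
theorem rowSum_mul_le {X Y : Matrix m m ℝ} {b : ℝ} (hY : ∀ k, ∑ j, |Y k j| ≤ b) (i : m) :
    ∑ j, |(X * Y) i j| ≤ (∑ k, |X i k|) * b := by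
  calc ∑ j, |(X * Y) i j| = ∑ j, |∑ k, X i k * Y k j| := by simp only [Matrix.mul_apply]
    _ ≤ ∑ j, ∑ k, |X i k| * |Y k j| := Finset.sum_le_sum fun j _ => (Finset.abs_sum_le_sum_abs _ _).trans
        (le_of_eq (Finset.sum_congr rfl fun k _ => abs_mul _ _))
    _ = ∑ k, |X i k| * ∑ j, |Y k j| := by rw [Finset.sum_comm]; exact Finset.sum_congr rfl fun k _ => by rw [Finset.mul_sum]
    _ ≤ ∑ k, |X i k| * b := Finset.sum_le_sum fun k _ => mul_le_mul_of_nonneg_left (hY k) (abs_nonneg _)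
    _ = (∑ k, |X i k|) * b := by rw [Finset.sum_mul]

/-- **COVARIANCE-SIDE DOOR TO THE ROW HYPOTHESIS**: for invertible covariances `G₁, G₂` whose precisions have absolute row sums `≤ M₁`, `≤ M₂` and with
`Σ_{e′}|G₂ e e′ − G₁ e e′| ≤ δ`, the precisions differ row-wise by at most `M₂·δ·M₁`: `G₂⁻¹ − G₁⁻¹ = G₂⁻¹(G₁ − G₂)G₁⁻¹`.  (An image sum
`G₂ = Σ_n G₁(·, · + nP)` of an exponentially decaying `G₁` is such a `δ`-perturbation; nothing about it is constructed here.)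
[cite: HornJohnson2013, §5.6 (submultiplicativity), §0.7.4 (`B⁻¹ − A⁻¹ = B⁻¹(A − B)A⁻¹`)] -/
theorem rows_inv_sub_inv_le {G₁ G₂ : Matrix m m ℝ} (hG₁ : IsUnit G₁.det) (hG₂ : IsUnit G₂.det) {M₁ M₂ δ : ℝ}
    (hM₁ : ∀ e, ∑ e', |(G₁⁻¹ : Matrix m m ℝ) e e'| ≤ M₁) (hM₂ : ∀ e, ∑ e', |(G₂⁻¹ : Matrix m m ℝ) e e'| ≤ M₂)
    (hδ : ∀ e, ∑ e', |G₂ e e' - G₁ e e'| ≤ δ) (e : m) :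
    ∑ e', |(G₂⁻¹ : Matrix m m ℝ) e e' - (G₁⁻¹ : Matrix m m ℝ) e e'| ≤ M₂ * δ * M₁ := by
  have hid : (G₂⁻¹ : Matrix m m ℝ) - G₁⁻¹ = G₂⁻¹ * (G₁ - G₂) * G₁⁻¹ := by
    rw [Matrix.mul_sub, Matrix.sub_mul, Matrix.nonsing_inv_mul _ hG₂, Matrix.one_mul, Matrix.mul_assoc,
      Matrix.mul_nonsing_inv _ hG₁, Matrix.mul_one]
  have hδ' : ∀ k, ∑ j, |(G₁ - G₂) k j| ≤ δ := fun k => by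
    simpa only [Matrix.sub_apply, abs_sub_comm] using hδ k
  have hδ0 : 0 ≤ δ := by
    rcases isEmpty_or_nonempty m with hm | ⟨⟨k⟩⟩
    · exact le_trans (le_of_eq (by simp)) (le_trans (Finset.sum_nonneg fun _ _ => abs_nonneg _) (hδ e))
    · exact le_trans (Finset.sum_nonneg fun _ _ => abs_nonneg _) (hδ k)
  calc ∑ e', |(G₂⁻¹ : Matrix m m ℝ) e e' - (G₁⁻¹ : Matrix m m ℝ) e e'|
      = ∑ e', |((G₂⁻¹ : Matrix m m ℝ) * (G₁ - G₂) * G₁⁻¹) e e'| := Finset.sum_congr rfl fun e' _ => by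
        rw [← Matrix.sub_apply, hid]
    _ ≤ (∑ k, |((G₂⁻¹ : Matrix m m ℝ) * (G₁ - G₂)) e k|) * M₁ := rowSum_mul_le hM₁ e
    _ ≤ ((∑ k, |(G₂⁻¹ : Matrix m m ℝ) e k|) * δ) * M₁ := by
        have hM₁0 : 0 ≤ M₁ := le_trans (Finset.sum_nonneg fun _ _ => abs_nonneg _) (hM₁ e)
        exact mul_le_mul_of_nonneg_right (rowSum_mul_le hδ' e) hM₁0
    _ ≤ (M₂ * δ) * M₁ := by
        have hM₁0 : 0 ≤ M₁ := le_trans (Finset.sum_nonneg fun _ _ => abs_nonneg _) (hM₁ e)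
        exact mul_le_mul_of_nonneg_right (mul_le_mul_of_nonneg_right (hM₂ e) hδ0) hM₁0

end MatrixPart

/-! ## §2  Gaussian currency: two precisions with close rows, observables supported where `Σ_e r_e y_e² ≤ T` -/

section Gaussian

variable {m : Type*} [Fintype m] [DecidableEq m]

/-- ★ **TWO-PRECISION SANDWICH ON A RESTRICTED SUPPORT**: for symmetric `A₁` (`γ`-coercive, `γ > 0`) and `A₂` with `Σ_{e′}|A₂ e e′ − A₁ e e′| ≤ r_e ≤
r_max < γ`, and a measurable `F ≥ 0` with `F y ≠ 0 → Σ_e r_e y_e² ≤ T`: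
`∫⁻F dN(0,A₂⁻¹) ≤ e^{ρ/2 + T/2}·∫⁻F dN(0,A₁⁻¹)` and `e^{−(ρ/2 + T/2)}·∫⁻F dN(0,A₁⁻¹) ≤ ∫⁻F dN(0,A₂⁻¹)`, `ρ = Σ_e r_e/(γ − r_max)` — seat n08-d's
restricted-support sandwich with the form difference `|⟨y,A₂y⟩ − ⟨y,A₁y⟩| ≤ Σ_e r_e y_e² ≤ T` and §1's normalisation ratio.
[cite: HornJohnson2013, §7.1, Cor. 7.7.4; BenfattoEtAl1978, (5.13) p.155 (class substitute; ours)] -/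
theorem lintegral_multivariateGaussian_bounds_of_rows_on {A₁ A₂ : Matrix m m ℝ} (hA₁ : ∀ y y', A₁ y y' = A₁ y' y)
    (hA₂ : ∀ y y', A₂ y y' = A₂ y' y) {γ rmax : ℝ} (hγ0 : 0 < γ) (r : m → ℝ)
    (hγ : ∀ x : m → ℝ, γ * ∑ y, x y ^ 2 ≤ ∑ y, ∑ y', A₁ y y' * x y * x y')
    (hr : ∀ y, ∑ y', |A₂ y y' - A₁ y y'| ≤ r y) (hrmax : ∀ y, r y ≤ rmax) (hγr : rmax < γ)
    {T : ℝ} {F : EuclideanSpace ℝ m → ℝ≥0∞} (hF : Measurable F) (hsupp : ∀ y, F y ≠ 0 → ∑ e, r e * (ofLp y) e ^ 2 ≤ T) :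
    ∫⁻ y, F y ∂(multivariateGaussian 0 A₂⁻¹) ≤
        ENNReal.ofReal (Real.exp ((∑ y, r y) / (γ - rmax) / 2 + T / 2)) * ∫⁻ y, F y ∂(multivariateGaussian 0 A₁⁻¹) ∧
      ENNReal.ofReal (Real.exp (-((∑ y, r y) / (γ - rmax) / 2 + T / 2))) * ∫⁻ y, F y ∂(multivariateGaussian 0 A₁⁻¹) ≤
        ∫⁻ y, F y ∂(multivariateGaussian 0 A₂⁻¹) := by
  have hγ' : 0 < γ - rmax := by linarith
  have hA₁pd : A₁.PosDef := posDef_of_coercive hA₁ hγ0 hγ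
  have hA₂pd : A₂.PosDef := posDef_of_coercive hA₂ hγ' (coercive_of_rows hA₁ hA₂ r hγ hr hrmax)
  have hDs : ∀ y y', (A₂ y y' - A₁ y y') = (A₂ y' y - A₁ y' y) := fun y y' => by rw [hA₁ y y', hA₂ y y']
  -- the support condition in form currency
  have hsupp' : ∀ y, F y ≠ 0 → |ofLp y ⬝ᵥ A₂ *ᵥ ofLp y - ofLp y ⬝ᵥ A₁ *ᵥ ofLp y| ≤ T := by
    intro y hy
    rw [dot_form_eq, dot_form_eq, form_split A₁ A₂ (ofLp y), add_sub_cancel_left]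
    exact (abs_form_le_diag_of_rows (D := fun e e' => A₂ e e' - A₁ e e') hDs r hr (ofLp y)).trans (hsupp y hy)
  obtain ⟨hZle, hZge⟩ := gaussZ_ratio_bounds_of_rows hA₁ hA₂ hγ0 r hγ hr hrmax hγr
  have hup := lintegral_multivariateGaussian_le_of_form_sub_le_on hA₂pd hA₁pd hF hsupp'
  have hlow := lintegral_multivariateGaussian_ge_of_form_sub_le_on hA₂pd hA₁pd hF hsupp'
  constructor
  · refine hup.trans ?_
    rw [Real.exp_add, ENNReal.ofReal_mul (Real.exp_pos _).le]
    exact mul_le_mul' (mul_le_mul' hZle le_rfl) le_rfl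
  · refine le_trans ?_ hlow
    rw [neg_add, Real.exp_add, ENNReal.ofReal_mul (Real.exp_pos _).le]
    exact mul_le_mul' (mul_le_mul' hZge le_rfl) le_rfl

end Gaussian

/-! ## §3  Field currency: two zero-extended members on one window -/

section Field

variable {Λ : Finset (B1Eq324BenfattoLemma.Site d)} {A₁ A₂ : Matrix Λ Λ ℝ}
  {K₁ K₂ : B1Eq324BenfattoLemma.Site d → B1Eq324BenfattoLemma.Site d → ℝ}
  (hK₁ : ∀ x y, K₁ x y = if h : x ∈ Λ ∧ y ∈ Λ then (A₁⁻¹ : Matrix Λ Λ ℝ) ⟨x, h.1⟩ ⟨y, h.2⟩ else 0)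
  (hK₂ : ∀ x y, K₂ x y = if h : x ∈ Λ ∧ y ∈ Λ then (A₂⁻¹ : Matrix Λ Λ ℝ) ⟨x, h.1⟩ ⟨y, h.2⟩ else 0)

/-- The extension-by-zero of a window configuration is measurable. [folklore] -/
private theorem measurable_ext (Λ : Finset (B1Eq324BenfattoLemma.Site d)) :
    Measurable fun (w : Λ → ℝ) (x : B1Eq324BenfattoLemma.Site d) => if h : x ∈ Λ then w ⟨x, h⟩ else 0 := by
  refine measurable_pi_lambda _ fun x => ?_
  by_cases h : x ∈ Λ
  · simp only [dif_pos h]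
    exact measurable_pi_apply _
  · simp only [dif_neg h]
    exact measurable_const

/-- **A member's expectation of ANY observable is a window expectation**: under `𝒩(0,K)` (`K = A⁻¹` zero-extended, `A ≻ 0`) the field vanishes a.s.
off `Λ`, so `∫⁻F d𝒩(0,K) = ∫⁻ F(ext y) dN(0,A⁻¹)(y)` with `ext` the extension by zero. [cite: BenfattoEtAl1978, §1 p.144, Appendix C (C.6) p.164 (class form; ours)] -/
theorem lintegral_eq_lintegral_window {A : Matrix Λ Λ ℝ} {K : B1Eq324BenfattoLemma.Site d → B1Eq324BenfattoLemma.Site d → ℝ}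
    (hK : ∀ x y, K x y = if h : x ∈ Λ ∧ y ∈ Λ then (A⁻¹ : Matrix Λ Λ ℝ) ⟨x, h.1⟩ ⟨y, h.2⟩ else 0) (hA : A.PosDef)
    {F : (B1Eq324BenfattoLemma.Site d → ℝ) → ℝ≥0∞} (hF : Measurable F) :
    ∫⁻ z, F z ∂gaussianFieldOfKernel K =
      ∫⁻ y, F (fun x => if h : x ∈ Λ then (ofLp y : Λ → ℝ) ⟨x, h⟩ else 0) ∂multivariateGaussian 0 A⁻¹ := by
  have hKpsd : IsPosSemidefKernel K := isPosSemidefKernel_kernel hK hA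
  have hG : Measurable fun w : Λ → ℝ => F (fun x => if h : x ∈ Λ then w ⟨x, h⟩ else 0) := hF.comp (measurable_ext Λ)
  calc ∫⁻ z, F z ∂gaussianFieldOfKernel K
      = ∫⁻ z, (fun w : Λ → ℝ => F (fun x => if h : x ∈ Λ then w ⟨x, h⟩ else 0)) (Λ.restrict z) ∂gaussianFieldOfKernel K := by
        refine lintegral_congr_ae ?_
        filter_upwards [ae_eq_zero_of_not_mem hK hA] with z hz
        congr 1
        funext x
        by_cases h : x ∈ Λ
        · rw [dif_pos h]; rfl
        · rw [dif_neg h, hz x h]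
    _ = ∫⁻ y, F (fun x => if h : x ∈ Λ then (ofLp y : Λ → ℝ) ⟨x, h⟩ else 0) ∂multivariateGaussian 0 (covGram K Λ) :=
        lintegral_comp_restrict_eq hKpsd Λ hG
    _ = ∫⁻ y, F (fun x => if h : x ∈ Λ then (ofLp y : Λ → ℝ) ⟨x, h⟩ else 0) ∂multivariateGaussian 0 A⁻¹ := by
        rw [covGram_kernel_eq_inv hK]

include hK₁ hK₂

/-- ★★ **TWO MEMBERS ON ONE WINDOW, FIELD CURRENCY**: `(Λ, A₁, K₁)`, `(Λ, A₂, K₂)` class members (zero-extended inverses), `A₁` symmetric `γ`-coercive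
(`γ > 0`), `A₂` symmetric, `Σ_{e′}|A₂ e e′ − A₁ e e′| ≤ r_e ≤ r_max < γ`; `F ≥ 0` measurable on `ℝ^{ℤ^d}` with `F z ≠ 0 → |z_e| ≤ B_e` for every `e ∈ Λ`.
Then `∫⁻F d𝒩(0,K₂) ≤ e^{E}∫⁻F d𝒩(0,K₁)` and `e^{−E}∫⁻F d𝒩(0,K₁) ≤ ∫⁻F d𝒩(0,K₂)`, `E = Σ_e r_e/(2(γ − r_max)) + ½Σ_e r_e B_e²`.
[cite: BenfattoEtAl1978, (4.6)–(4.7) p.152, (5.13) p.155; Balaban1985BackgroundPropagators, Sect. E p.428 (class form; ours)] -/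
theorem lintegral_bounds_of_rows (hA₁ : ∀ e e', A₁ e e' = A₁ e' e) (hA₂ : ∀ e e', A₂ e e' = A₂ e' e) {γ rmax : ℝ} (hγ0 : 0 < γ)
    (r : Λ → ℝ) (hγ : ∀ x : Λ → ℝ, γ * ∑ e, x e ^ 2 ≤ ∑ e, ∑ e', A₁ e e' * x e * x e')
    (hr : ∀ e, ∑ e', |A₂ e e' - A₁ e e'| ≤ r e) (hrmax : ∀ e, r e ≤ rmax) (hγr : rmax < γ)
    (B : Λ → ℝ) {F : (B1Eq324BenfattoLemma.Site d → ℝ) → ℝ≥0∞} (hF : Measurable F)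
    (hsupp : ∀ z, F z ≠ 0 → ∀ e : Λ, |z e| ≤ B e) :
    ∫⁻ z, F z ∂gaussianFieldOfKernel K₂ ≤
        ENNReal.ofReal (Real.exp ((∑ e, r e) / (γ - rmax) / 2 + (∑ e, r e * B e ^ 2) / 2)) * ∫⁻ z, F z ∂gaussianFieldOfKernel K₁ ∧
      ENNReal.ofReal (Real.exp (-((∑ e, r e) / (γ - rmax) / 2 + (∑ e, r e * B e ^ 2) / 2))) * ∫⁻ z, F z ∂gaussianFieldOfKernel K₁ ≤
        ∫⁻ z, F z ∂gaussianFieldOfKernel K₂ := by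
  have hγ' : 0 < γ - rmax := by linarith
  have hA₁pd : A₁.PosDef := posDef_of_coercive hA₁ hγ0 hγ
  have hA₂pd : A₂.PosDef := posDef_of_coercive hA₂ hγ' (coercive_of_rows hA₁ hA₂ r hγ hr hrmax)
  have hr0 : ∀ e, 0 ≤ r e := fun e => le_trans (Finset.sum_nonneg fun _ _ => abs_nonneg _) (hr e)
  rw [lintegral_eq_lintegral_window hK₁ hA₁pd hF, lintegral_eq_lintegral_window hK₂ hA₂pd hF]
  have hG : Measurable fun y : EuclideanSpace ℝ Λ => F (fun x => if h : x ∈ Λ then (ofLp y : Λ → ℝ) ⟨x, h⟩ else 0) :=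
    (hF.comp (measurable_ext Λ)).comp (MeasurableEquiv.toLp 2 (Λ → ℝ)).symm.measurable
  refine lintegral_multivariateGaussian_bounds_of_rows_on hA₁ hA₂ hγ0 r hγ hr hrmax hγr hG fun y hy => ?_
  -- on the support every window coordinate is in its box
  have hbox := hsupp _ hy
  refine Finset.sum_le_sum fun e _ => mul_le_mul_of_nonneg_left ?_ (hr0 e)
  have he := hbox e
  rw [dif_pos e.2] at he
  have hB0 : 0 ≤ B e := (abs_nonneg _).trans he
  calc (ofLp y) e ^ 2 = |(ofLp y) e| ^ 2 := (sq_abs _).symm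
    _ ≤ B e ^ 2 := pow_le_pow_left₀ (abs_nonneg _) he 2

/-! ## §4  Real observables, the class integrand `Π_Δχ̂_Δ e^{H_J}`, and the factor form -/

/-- ★★ **TWO MEMBERS ON ONE WINDOW, BOCHNER CURRENCY**: for a measurable REAL `f ≥ 0` with `f z ≠ 0 → |z_e| ≤ B_e` (`e ∈ Λ`),
`∫f d𝒩(0,K₂) ≤ e^{E}·∫f d𝒩(0,K₁)` and `e^{−E}·∫f d𝒩(0,K₁) ≤ ∫f d𝒩(0,K₂)` with the `E` of `lintegral_bounds_of_rows` (no integrability hypothesis: both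
sides vanish together when the reference integral diverges). [cite: BenfattoEtAl1978, (4.6)–(4.7) p.152, (5.13) p.155 (class form; ours)] -/
theorem integral_bounds_of_rows (hA₁ : ∀ e e', A₁ e e' = A₁ e' e) (hA₂ : ∀ e e', A₂ e e' = A₂ e' e) {γ rmax : ℝ} (hγ0 : 0 < γ)
    (r : Λ → ℝ) (hγ : ∀ x : Λ → ℝ, γ * ∑ e, x e ^ 2 ≤ ∑ e, ∑ e', A₁ e e' * x e * x e')
    (hr : ∀ e, ∑ e', |A₂ e e' - A₁ e e'| ≤ r e) (hrmax : ∀ e, r e ≤ rmax) (hγr : rmax < γ)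
    (B : Λ → ℝ) {f : (B1Eq324BenfattoLemma.Site d → ℝ) → ℝ} (hf : Measurable f) (hf0 : ∀ z, 0 ≤ f z)
    (hsupp : ∀ z, f z ≠ 0 → ∀ e : Λ, |z e| ≤ B e) :
    ∫ z, f z ∂gaussianFieldOfKernel K₂ ≤
        Real.exp ((∑ e, r e) / (γ - rmax) / 2 + (∑ e, r e * B e ^ 2) / 2) * ∫ z, f z ∂gaussianFieldOfKernel K₁ ∧
      Real.exp (-((∑ e, r e) / (γ - rmax) / 2 + (∑ e, r e * B e ^ 2) / 2)) * ∫ z, f z ∂gaussianFieldOfKernel K₁ ≤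
        ∫ z, f z ∂gaussianFieldOfKernel K₂ := by
  set E : ℝ := (∑ e, r e) / (γ - rmax) / 2 + (∑ e, r e * B e ^ 2) / 2 with hE
  have hF : Measurable fun z => ENNReal.ofReal (f z) := ENNReal.measurable_ofReal.comp hf
  have hsuppF : ∀ z, ENNReal.ofReal (f z) ≠ 0 → ∀ e : Λ, |z e| ≤ B e := fun z hz =>
    hsupp z fun h => hz (by rw [h, ENNReal.ofReal_zero])
  obtain ⟨hup, hlow⟩ := lintegral_bounds_of_rows hK₁ hK₂ hA₁ hA₂ hγ0 r hγ hr hrmax hγr B hF hsuppF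
  have h1 : ∫ z, f z ∂gaussianFieldOfKernel K₁ = (∫⁻ z, ENNReal.ofReal (f z) ∂gaussianFieldOfKernel K₁).toReal :=
    integral_eq_lintegral_of_nonneg_ae (Filter.Eventually.of_forall hf0) hf.aestronglyMeasurable
  have h2 : ∫ z, f z ∂gaussianFieldOfKernel K₂ = (∫⁻ z, ENNReal.ofReal (f z) ∂gaussianFieldOfKernel K₂).toReal :=
    integral_eq_lintegral_of_nonneg_ae (Filter.Eventually.of_forall hf0) hf.aestronglyMeasurable
  set L₁ := ∫⁻ z, ENNReal.ofReal (f z) ∂gaussianFieldOfKernel K₁ with hL₁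
  set L₂ := ∫⁻ z, ENNReal.ofReal (f z) ∂gaussianFieldOfKernel K₂ with hL₂
  rw [h1, h2]
  by_cases htop : L₁ = ∞
  · -- the reference integral diverges: so does the other one, both Bochner integrals read `0`
    have h2top : L₂ = ∞ := by
      refine eq_top_iff.mpr (le_trans ?_ hlow)
      rw [htop, ENNReal.mul_top (ENNReal.ofReal_pos.2 (Real.exp_pos _)).ne']
    rw [htop, h2top, ENNReal.toReal_top, mul_zero, mul_zero]
    exact ⟨le_refl _, le_refl _⟩
  · have h2ne : L₂ ≠ ∞ := ne_top_of_le_ne_top (ENNReal.mul_ne_top ENNReal.ofReal_ne_top htop) hup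
    constructor
    · calc L₂.toReal ≤ (ENNReal.ofReal (Real.exp E) * L₁).toReal := ENNReal.toReal_mono (ENNReal.mul_ne_top ENNReal.ofReal_ne_top htop) hup
        _ = Real.exp E * L₁.toReal := by rw [ENNReal.toReal_mul, ENNReal.toReal_ofReal (Real.exp_pos _).le]
    · calc Real.exp (-E) * L₁.toReal = (ENNReal.ofReal (Real.exp (-E)) * L₁).toReal := by
            rw [ENNReal.toReal_mul, ENNReal.toReal_ofReal (Real.exp_pos _).le]
        _ ≤ L₂.toReal := ENNReal.toReal_mono h2ne hlow

/-- ★★★ **THE CUT-OFF EXPONENTIAL MOMENT OF TWO CLOSE MEMBERS**: for every `s, D, ϰ, 𝔄, J`, every `I` and `b ≥ 0`,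
`e^{−E}·∫Π_Δχ̂^I_bΔ e^{H_J} d𝒩(0,K₁) ≤ ∫Π_Δχ̂^I_b e^{H_J} d𝒩(0,K₂) ≤ e^{E}·∫Π_Δχ̂^I_b e^{H_J} d𝒩(0,K₁)` with
`E = Σ_e r_e/(2(γ − r_max)) + (b²/2)·Σ_{e∈Λ} r_e (1 + d(I,Δ_e))²` — the small-field cut-off puts every window coordinate in the box `|z_e| ≤ b(1 + d(I,Δ_e))`.
[cite: BenfattoEtAl1978, (4.6)–(4.7) p.152 with (A.1) p.161, (5.13) p.155; Balaban1985BackgroundPropagators, Sect. E p.428 (class form; ours)] -/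
theorem integral_cutoffBoltzmann_bounds_of_rows (hA₁ : ∀ e e', A₁ e e' = A₁ e' e) (hA₂ : ∀ e e', A₂ e e' = A₂ e' e) {γ rmax : ℝ}
    (hγ0 : 0 < γ) (r : Λ → ℝ) (hγ : ∀ x : Λ → ℝ, γ * ∑ e, x e ^ 2 ≤ ∑ e, ∑ e', A₁ e e' * x e * x e')
    (hr : ∀ e, ∑ e', |A₂ e e' - A₁ e e'| ≤ r e) (hrmax : ∀ e, r e ≤ rmax) (hγr : rmax < γ)
    (s D : ℕ) (ϰ : ℝ) (a : Coef d) (I J : Finset (B1Eq324BenfattoLemma.Site d)) (b : ℝ) :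
    ∫ z, cutoffBoltzmann (hamiltonian s D ϰ a J) I b z ∂gaussianFieldOfKernel K₂ ≤
        Real.exp ((∑ e, r e) / (γ - rmax) / 2 + (∑ e, r e * (b * (1 + distToRegion I e)) ^ 2) / 2) *
          ∫ z, cutoffBoltzmann (hamiltonian s D ϰ a J) I b z ∂gaussianFieldOfKernel K₁ ∧
      Real.exp (-((∑ e, r e) / (γ - rmax) / 2 + (∑ e, r e * (b * (1 + distToRegion I e)) ^ 2) / 2)) *
          ∫ z, cutoffBoltzmann (hamiltonian s D ϰ a J) I b z ∂gaussianFieldOfKernel K₁ ≤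
        ∫ z, cutoffBoltzmann (hamiltonian s D ϰ a J) I b z ∂gaussianFieldOfKernel K₂ := by
  refine integral_bounds_of_rows hK₁ hK₂ hA₁ hA₂ hγ0 r hγ hr hrmax hγr (fun e : Λ => b * (1 + distToRegion I e))
    (measurable_cutoffBoltzmann_hamiltonian a J I b) (fun z => ?_) (fun z hz e => ?_)
  · unfold cutoffBoltzmann
    exact Set.indicator_nonneg (fun _ _ => (Real.exp_pos _).le) z
  · have hmem : z ∈ smallFieldSet I b := by
      by_contra h
      exact hz (by rw [cutoffBoltzmann, Set.indicator_of_notMem h])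
    exact hmem e

/-- **THE FACTOR FORM** (the shape seat n08-w4's `…ClassSocketApprox` consumes: `Z′ = Z·w`, `e^{−E} ≤ w ≤ e^{E}`): there is `w ∈ [e^{−E}, e^{E}]` with
`∫Πχ̂e^{H_J} d𝒩(0,K₂) = (∫Πχ̂e^{H_J} d𝒩(0,K₁))·w`. [cite: BenfattoEtAl1978, (4.6)–(4.7) p.152, (5.13) p.155 (class form; ours)] -/
theorem exists_factor_integral_cutoffBoltzmann_of_rows (hA₁ : ∀ e e', A₁ e e' = A₁ e' e) (hA₂ : ∀ e e', A₂ e e' = A₂ e' e) {γ rmax : ℝ}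
    (hγ0 : 0 < γ) (r : Λ → ℝ) (hγ : ∀ x : Λ → ℝ, γ * ∑ e, x e ^ 2 ≤ ∑ e, ∑ e', A₁ e e' * x e * x e')
    (hr : ∀ e, ∑ e', |A₂ e e' - A₁ e e'| ≤ r e) (hrmax : ∀ e, r e ≤ rmax) (hγr : rmax < γ)
    (s D : ℕ) (ϰ : ℝ) (a : Coef d) (I J : Finset (B1Eq324BenfattoLemma.Site d)) (b : ℝ) :
    ∃ w : ℝ, Real.exp (-((∑ e, r e) / (γ - rmax) / 2 + (∑ e, r e * (b * (1 + distToRegion I e)) ^ 2) / 2)) ≤ w ∧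
      w ≤ Real.exp ((∑ e, r e) / (γ - rmax) / 2 + (∑ e, r e * (b * (1 + distToRegion I e)) ^ 2) / 2) ∧
      ∫ z, cutoffBoltzmann (hamiltonian s D ϰ a J) I b z ∂gaussianFieldOfKernel K₂ =
        (∫ z, cutoffBoltzmann (hamiltonian s D ϰ a J) I b z ∂gaussianFieldOfKernel K₁) * w := by
  set E : ℝ := (∑ e, r e) / (γ - rmax) / 2 + (∑ e, r e * (b * (1 + distToRegion I e)) ^ 2) / 2 with hE
  obtain ⟨hup, hlow⟩ := integral_cutoffBoltzmann_bounds_of_rows hK₁ hK₂ hA₁ hA₂ hγ0 r hγ hr hrmax hγr s D ϰ a I J b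
  set Z₁ := ∫ z, cutoffBoltzmann (hamiltonian s D ϰ a J) I b z ∂gaussianFieldOfKernel K₁ with hZ₁
  set Z₂ := ∫ z, cutoffBoltzmann (hamiltonian s D ϰ a J) I b z ∂gaussianFieldOfKernel K₂ with hZ₂
  have hZ₁0 : 0 ≤ Z₁ := integral_nonneg fun z => by
    unfold cutoffBoltzmann
    exact Set.indicator_nonneg (fun _ _ => (Real.exp_pos _).le) z
  have hle : Real.exp (-E) ≤ Real.exp E := Real.exp_le_exp.2 (by
    have : 0 ≤ E := by
      have hr0 : ∀ e, 0 ≤ r e := fun e => le_trans (Finset.sum_nonneg fun _ _ => abs_nonneg _) (hr e)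
      have hγ' : 0 < γ - rmax := by linarith
      rw [hE]
      exact add_nonneg (div_nonneg (div_nonneg (Finset.sum_nonneg fun e _ => hr0 e) hγ'.le) zero_le_two)
        (div_nonneg (Finset.sum_nonneg fun e _ => mul_nonneg (hr0 e) (sq_nonneg _)) zero_le_two)
    linarith)
  rcases eq_or_lt_of_le hZ₁0 with hz | hz
  · -- `Z₁ = 0` forces `Z₂ = 0`; take `w = e^{E}`
    refine ⟨Real.exp E, hle, le_rfl, ?_⟩
    have hZ₂0 : Z₂ ≤ 0 := by rw [← hz, mul_zero] at hup; exact hup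
    have hZ₂0' : 0 ≤ Z₂ := by
      have := hlow; rw [← hz, mul_zero] at this; exact this
    rw [← hz, zero_mul]
    exact le_antisymm hZ₂0 hZ₂0'
  · refine ⟨Z₂ / Z₁, ?_, ?_, ?_⟩
    · rw [le_div_iff₀ hz]; exact hlow
    · rw [div_le_iff₀ hz]; exact hup
    · rw [mul_div_cancel₀ _ hz.ne']

end Field

/-! ## §5 (v1.1)  BOTH MEMBERS COERCIVE ON THEIR OWN: no `r_max < γ` — the difference rows may be large where they live (e.g. on a seam),
the price is paid through `Σ_e r_e` and the support only -/

section BothCoercive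

variable {m : Type*} [Fintype m] [DecidableEq m]

/-- **Determinant ratio, two coercivities**: `A₁` symmetric `γ₁`-coercive, `A₂` symmetric `γ₂`-coercive (`γ₁, γ₂ > 0`), `Σ_{e′}|A₂ e e′ − A₁ e e′| ≤ r_e`
(no bound on `r_e` against `γ_i` asked): `det A₂ ≤ det A₁·e^{Σ_e r_e/γ₁}` and `det A₁ ≤ det A₂·e^{Σ_e r_e/γ₂}`.
[cite: HornJohnson2013, Cor. 7.7.4, §0.8.5 with §7.1; BenfattoEtAl1978, (5.13) p.155 (class substitute; ours)] -/
theorem det_le_det_mul_exp_of_rows₂ {A₁ A₂ : Matrix m m ℝ} (hA₁ : ∀ y y', A₁ y y' = A₁ y' y) (hA₂ : ∀ y y', A₂ y y' = A₂ y' y)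
    {γ₁ γ₂ : ℝ} (hγ₁0 : 0 < γ₁) (hγ₂0 : 0 < γ₂) (r : m → ℝ)
    (hγ₁ : ∀ x : m → ℝ, γ₁ * ∑ y, x y ^ 2 ≤ ∑ y, ∑ y', A₁ y y' * x y * x y')
    (hγ₂ : ∀ x : m → ℝ, γ₂ * ∑ y, x y ^ 2 ≤ ∑ y, ∑ y', A₂ y y' * x y * x y')
    (hr : ∀ y, ∑ y', |A₂ y y' - A₁ y y'| ≤ r y) :
    A₂.det ≤ A₁.det * Real.exp ((∑ y, r y) / γ₁) ∧ A₁.det ≤ A₂.det * Real.exp ((∑ y, r y) / γ₂) := by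
  have hr' : ∀ y, ∑ y', |A₁ y y' - A₂ y y'| ≤ r y := fun y => by
    simpa only [abs_sub_comm] using hr y
  exact ⟨det_le_det_mul_exp_core hA₁ hA₂ hγ₁0 r hγ₁ (posDef_of_coercive hA₂ hγ₂0 hγ₂).posSemidef hr,
    det_le_det_mul_exp_core hA₂ hA₁ hγ₂0 r hγ₂ (posDef_of_coercive hA₁ hγ₁0 hγ₁).posSemidef hr'⟩

/-- **The square-root determinant ratios, two coercivities**: `√(det A₂/det A₁) ≤ e^{Σr/(2γ₁)}`, `√(det A₁/det A₂) ≤ e^{Σr/(2γ₂)}`.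
[cite: HornJohnson2013, Cor. 7.7.4 with §7.1] -/
theorem sqrt_det_ratio_le_exp_of_rows₂ {A₁ A₂ : Matrix m m ℝ} (hA₁ : ∀ y y', A₁ y y' = A₁ y' y) (hA₂ : ∀ y y', A₂ y y' = A₂ y' y)
    {γ₁ γ₂ : ℝ} (hγ₁0 : 0 < γ₁) (hγ₂0 : 0 < γ₂) (r : m → ℝ)
    (hγ₁ : ∀ x : m → ℝ, γ₁ * ∑ y, x y ^ 2 ≤ ∑ y, ∑ y', A₁ y y' * x y * x y')
    (hγ₂ : ∀ x : m → ℝ, γ₂ * ∑ y, x y ^ 2 ≤ ∑ y, ∑ y', A₂ y y' * x y * x y')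
    (hr : ∀ y, ∑ y', |A₂ y y' - A₁ y y'| ≤ r y) :
    Real.sqrt (A₂.det / A₁.det) ≤ Real.exp ((∑ y, r y) / γ₁ / 2) ∧
      Real.sqrt (A₁.det / A₂.det) ≤ Real.exp ((∑ y, r y) / γ₂ / 2) := by
  obtain ⟨h12, h21⟩ := det_le_det_mul_exp_of_rows₂ hA₁ hA₂ hγ₁0 hγ₂0 r hγ₁ hγ₂ hr
  have hd1 : 0 < A₁.det := (posDef_of_coercive hA₁ hγ₁0 hγ₁).det_pos
  have hd2 : 0 < A₂.det := (posDef_of_coercive hA₂ hγ₂0 hγ₂).det_pos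
  have hsq : ∀ c : ℝ, Real.exp (c / 2) ^ 2 = Real.exp c := fun c => by
    rw [← Real.exp_nat_mul]; congr 1; ring
  constructor
  · refine Real.sqrt_le_iff.mpr ⟨(Real.exp_pos _).le, ?_⟩
    rw [hsq, div_le_iff₀ hd1]
    linarith
  · refine Real.sqrt_le_iff.mpr ⟨(Real.exp_pos _).le, ?_⟩
    rw [hsq, div_le_iff₀ hd2]
    linarith

/-- **The normalisation ratio, two coercivities**: `Z_{A₂}⁻¹Z_{A₁} = √(det A₂/det A₁) ≤ e^{Σr/(2γ₁)}` and `e^{−Σr/(2γ₂)} ≤ Z_{A₂}⁻¹Z_{A₁}`.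
[cite: HornJohnson2013, §7.1, Cor. 7.7.4] -/
theorem gaussZ_ratio_bounds_of_rows₂ {A₁ A₂ : Matrix m m ℝ} (hA₁ : ∀ y y', A₁ y y' = A₁ y' y) (hA₂ : ∀ y y', A₂ y y' = A₂ y' y)
    {γ₁ γ₂ : ℝ} (hγ₁0 : 0 < γ₁) (hγ₂0 : 0 < γ₂) (r : m → ℝ)
    (hγ₁ : ∀ x : m → ℝ, γ₁ * ∑ y, x y ^ 2 ≤ ∑ y, ∑ y', A₁ y y' * x y * x y')
    (hγ₂ : ∀ x : m → ℝ, γ₂ * ∑ y, x y ^ 2 ≤ ∑ y, ∑ y', A₂ y y' * x y * x y')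
    (hr : ∀ y, ∑ y', |A₂ y y' - A₁ y y'| ≤ r y) :
    (gaussZ A₂)⁻¹ * gaussZ A₁ ≤ ENNReal.ofReal (Real.exp ((∑ y, r y) / γ₁ / 2)) ∧
      ENNReal.ofReal (Real.exp (-((∑ y, r y) / γ₂ / 2))) ≤ (gaussZ A₂)⁻¹ * gaussZ A₁ := by
  have hA₁pd : A₁.PosDef := posDef_of_coercive hA₁ hγ₁0 hγ₁
  have hA₂pd : A₂.PosDef := posDef_of_coercive hA₂ hγ₂0 hγ₂
  obtain ⟨h12, h21⟩ := sqrt_det_ratio_le_exp_of_rows₂ hA₁ hA₂ hγ₁0 hγ₂0 r hγ₁ hγ₂ hr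
  rw [gaussZ_inv_mul_gaussZ_eq hA₁pd hA₂pd]
  refine ⟨ENNReal.ofReal_le_ofReal h12, ENNReal.ofReal_le_ofReal ?_⟩
  have hd1 : 0 < A₁.det := hA₁pd.det_pos
  have hd2 : 0 < A₂.det := hA₂pd.det_pos
  have hs : Real.sqrt (A₁.det / A₂.det) * Real.sqrt (A₂.det / A₁.det) = 1 := by
    rw [← Real.sqrt_mul (div_pos hd1 hd2).le, div_mul_div_comm, mul_comm A₁.det, div_self (mul_pos hd2 hd1).ne', Real.sqrt_one]
  have hpos : 0 < Real.sqrt (A₂.det / A₁.det) := Real.sqrt_pos.2 (div_pos hd2 hd1)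
  rw [Real.exp_neg, inv_le_comm₀ (Real.exp_pos _) hpos]
  calc (Real.sqrt (A₂.det / A₁.det))⁻¹ = Real.sqrt (A₁.det / A₂.det) := by
        rw [eq_comm, ← mul_eq_one_iff_eq_inv₀ hpos.ne']
        exact hs
    _ ≤ Real.exp ((∑ y, r y) / γ₂ / 2) := h21

/-- ★ **TWO-PRECISION SANDWICH ON A RESTRICTED SUPPORT, two coercivities**: `A₁` symmetric `γ₁`-coercive, `A₂` symmetric `γ₂`-coercive,
`Σ_{e′}|A₂ e e′ − A₁ e e′| ≤ r_e`, `F ≥ 0` measurable with `F y ≠ 0 → Σ_e r_e y_e² ≤ T`: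
`∫⁻F dN(0,A₂⁻¹) ≤ e^{Σr/(2γ₁) + T/2}·∫⁻F dN(0,A₁⁻¹)` and `e^{−(Σr/(2γ₂) + T/2)}·∫⁻F dN(0,A₁⁻¹) ≤ ∫⁻F dN(0,A₂⁻¹)`.
[cite: HornJohnson2013, §7.1, Cor. 7.7.4; BenfattoEtAl1978, (5.13) p.155 (class substitute; ours)] -/
theorem lintegral_multivariateGaussian_bounds_of_rows_on₂ {A₁ A₂ : Matrix m m ℝ} (hA₁ : ∀ y y', A₁ y y' = A₁ y' y)
    (hA₂ : ∀ y y', A₂ y y' = A₂ y' y) {γ₁ γ₂ : ℝ} (hγ₁0 : 0 < γ₁) (hγ₂0 : 0 < γ₂) (r : m → ℝ)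
    (hγ₁ : ∀ x : m → ℝ, γ₁ * ∑ y, x y ^ 2 ≤ ∑ y, ∑ y', A₁ y y' * x y * x y')
    (hγ₂ : ∀ x : m → ℝ, γ₂ * ∑ y, x y ^ 2 ≤ ∑ y, ∑ y', A₂ y y' * x y * x y')
    (hr : ∀ y, ∑ y', |A₂ y y' - A₁ y y'| ≤ r y)
    {T : ℝ} {F : EuclideanSpace ℝ m → ℝ≥0∞} (hF : Measurable F) (hsupp : ∀ y, F y ≠ 0 → ∑ e, r e * (ofLp y) e ^ 2 ≤ T) :
    ∫⁻ y, F y ∂(multivariateGaussian 0 A₂⁻¹) ≤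
        ENNReal.ofReal (Real.exp ((∑ y, r y) / γ₁ / 2 + T / 2)) * ∫⁻ y, F y ∂(multivariateGaussian 0 A₁⁻¹) ∧
      ENNReal.ofReal (Real.exp (-((∑ y, r y) / γ₂ / 2 + T / 2))) * ∫⁻ y, F y ∂(multivariateGaussian 0 A₁⁻¹) ≤
        ∫⁻ y, F y ∂(multivariateGaussian 0 A₂⁻¹) := by
  have hA₁pd : A₁.PosDef := posDef_of_coercive hA₁ hγ₁0 hγ₁
  have hA₂pd : A₂.PosDef := posDef_of_coercive hA₂ hγ₂0 hγ₂
  have hDs : ∀ y y', (A₂ y y' - A₁ y y') = (A₂ y' y - A₁ y' y) := fun y y' => by rw [hA₁ y y', hA₂ y y']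
  have hsupp' : ∀ y, F y ≠ 0 → |ofLp y ⬝ᵥ A₂ *ᵥ ofLp y - ofLp y ⬝ᵥ A₁ *ᵥ ofLp y| ≤ T := by
    intro y hy
    rw [dot_form_eq, dot_form_eq, form_split A₁ A₂ (ofLp y), add_sub_cancel_left]
    exact (abs_form_le_diag_of_rows (D := fun e e' => A₂ e e' - A₁ e e') hDs r hr (ofLp y)).trans (hsupp y hy)
  obtain ⟨hZle, hZge⟩ := gaussZ_ratio_bounds_of_rows₂ hA₁ hA₂ hγ₁0 hγ₂0 r hγ₁ hγ₂ hr
  have hup := lintegral_multivariateGaussian_le_of_form_sub_le_on hA₂pd hA₁pd hF hsupp'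
  have hlow := lintegral_multivariateGaussian_ge_of_form_sub_le_on hA₂pd hA₁pd hF hsupp'
  constructor
  · refine hup.trans ?_
    rw [Real.exp_add, ENNReal.ofReal_mul (Real.exp_pos _).le]
    exact mul_le_mul' (mul_le_mul' hZle le_rfl) le_rfl
  · refine le_trans ?_ hlow
    rw [neg_add, Real.exp_add, ENNReal.ofReal_mul (Real.exp_pos _).le]
    exact mul_le_mul' (mul_le_mul' hZge le_rfl) le_rfl

end BothCoercive

section FieldBothCoercive

variable {Λ : Finset (B1Eq324BenfattoLemma.Site d)} {A₁ A₂ : Matrix Λ Λ ℝ}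
  {K₁ K₂ : B1Eq324BenfattoLemma.Site d → B1Eq324BenfattoLemma.Site d → ℝ}
  (hK₁ : ∀ x y, K₁ x y = if h : x ∈ Λ ∧ y ∈ Λ then (A₁⁻¹ : Matrix Λ Λ ℝ) ⟨x, h.1⟩ ⟨y, h.2⟩ else 0)
  (hK₂ : ∀ x y, K₂ x y = if h : x ∈ Λ ∧ y ∈ Λ then (A₂⁻¹ : Matrix Λ Λ ℝ) ⟨x, h.1⟩ ⟨y, h.2⟩ else 0)

include hK₁ hK₂

/-- ★★ **TWO MEMBERS ON ONE WINDOW, FIELD CURRENCY, two coercivities**: as `lintegral_bounds_of_rows` with `A₂` `γ₂`-coercive on its own instead of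
`r_e ≤ r_max < γ`: `∫⁻F d𝒩(0,K₂) ≤ e^{Σr/(2γ₁) + ½Σ_e r_e B_e²}∫⁻F d𝒩(0,K₁)` and `e^{−(Σr/(2γ₂) + ½Σ_e r_e B_e²)}∫⁻F d𝒩(0,K₁) ≤ ∫⁻F d𝒩(0,K₂)`.
[cite: BenfattoEtAl1978, (4.6)–(4.7) p.152, (5.13) p.155; Balaban1985BackgroundPropagators, Sect. E p.428 (class form; ours)] -/
theorem lintegral_bounds_of_rows₂ (hA₁ : ∀ e e', A₁ e e' = A₁ e' e) (hA₂ : ∀ e e', A₂ e e' = A₂ e' e) {γ₁ γ₂ : ℝ} (hγ₁0 : 0 < γ₁)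
    (hγ₂0 : 0 < γ₂) (r : Λ → ℝ) (hγ₁ : ∀ x : Λ → ℝ, γ₁ * ∑ e, x e ^ 2 ≤ ∑ e, ∑ e', A₁ e e' * x e * x e')
    (hγ₂ : ∀ x : Λ → ℝ, γ₂ * ∑ e, x e ^ 2 ≤ ∑ e, ∑ e', A₂ e e' * x e * x e')
    (hr : ∀ e, ∑ e', |A₂ e e' - A₁ e e'| ≤ r e)
    (B : Λ → ℝ) {F : (B1Eq324BenfattoLemma.Site d → ℝ) → ℝ≥0∞} (hF : Measurable F)
    (hsupp : ∀ z, F z ≠ 0 → ∀ e : Λ, |z e| ≤ B e) :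
    ∫⁻ z, F z ∂gaussianFieldOfKernel K₂ ≤
        ENNReal.ofReal (Real.exp ((∑ e, r e) / γ₁ / 2 + (∑ e, r e * B e ^ 2) / 2)) * ∫⁻ z, F z ∂gaussianFieldOfKernel K₁ ∧
      ENNReal.ofReal (Real.exp (-((∑ e, r e) / γ₂ / 2 + (∑ e, r e * B e ^ 2) / 2))) * ∫⁻ z, F z ∂gaussianFieldOfKernel K₁ ≤
        ∫⁻ z, F z ∂gaussianFieldOfKernel K₂ := by
  have hA₁pd : A₁.PosDef := posDef_of_coercive hA₁ hγ₁0 hγ₁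
  have hA₂pd : A₂.PosDef := posDef_of_coercive hA₂ hγ₂0 hγ₂
  have hr0 : ∀ e, 0 ≤ r e := fun e => le_trans (Finset.sum_nonneg fun _ _ => abs_nonneg _) (hr e)
  rw [lintegral_eq_lintegral_window hK₁ hA₁pd hF, lintegral_eq_lintegral_window hK₂ hA₂pd hF]
  have hG : Measurable fun y : EuclideanSpace ℝ Λ => F (fun x => if h : x ∈ Λ then (ofLp y : Λ → ℝ) ⟨x, h⟩ else 0) :=
    (hF.comp (measurable_ext Λ)).comp (MeasurableEquiv.toLp 2 (Λ → ℝ)).symm.measurable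
  refine lintegral_multivariateGaussian_bounds_of_rows_on₂ hA₁ hA₂ hγ₁0 hγ₂0 r hγ₁ hγ₂ hr hG fun y hy => ?_
  have hbox := hsupp _ hy
  refine Finset.sum_le_sum fun e _ => mul_le_mul_of_nonneg_left ?_ (hr0 e)
  have he := hbox e
  rw [dif_pos e.2] at he
  calc (ofLp y) e ^ 2 = |(ofLp y) e| ^ 2 := (sq_abs _).symm
    _ ≤ B e ^ 2 := pow_le_pow_left₀ (abs_nonneg _) he 2

/-- ★★ **Bochner currency, two coercivities**: for a measurable real `f ≥ 0` with `f z ≠ 0 → |z_e| ≤ B_e`, with the COMMON exponent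
`E := Σr/(2γ₁) + Σr/(2γ₂) + ½Σ_e r_e B_e²` (each one-sided exponent is `≤ E`): `∫f d𝒩(0,K₂) ≤ e^{E}∫f d𝒩(0,K₁)` and `e^{−E}∫f d𝒩(0,K₁) ≤ ∫f d𝒩(0,K₂)`.
[cite: BenfattoEtAl1978, (4.6)–(4.7) p.152, (5.13) p.155 (class form; ours)] -/
theorem integral_bounds_of_rows₂ (hA₁ : ∀ e e', A₁ e e' = A₁ e' e) (hA₂ : ∀ e e', A₂ e e' = A₂ e' e) {γ₁ γ₂ : ℝ} (hγ₁0 : 0 < γ₁)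
    (hγ₂0 : 0 < γ₂) (r : Λ → ℝ) (hγ₁ : ∀ x : Λ → ℝ, γ₁ * ∑ e, x e ^ 2 ≤ ∑ e, ∑ e', A₁ e e' * x e * x e')
    (hγ₂ : ∀ x : Λ → ℝ, γ₂ * ∑ e, x e ^ 2 ≤ ∑ e, ∑ e', A₂ e e' * x e * x e')
    (hr : ∀ e, ∑ e', |A₂ e e' - A₁ e e'| ≤ r e)
    (B : Λ → ℝ) {f : (B1Eq324BenfattoLemma.Site d → ℝ) → ℝ} (hf : Measurable f) (hf0 : ∀ z, 0 ≤ f z)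
    (hsupp : ∀ z, f z ≠ 0 → ∀ e : Λ, |z e| ≤ B e) :
    ∫ z, f z ∂gaussianFieldOfKernel K₂ ≤
        Real.exp ((∑ e, r e) / γ₁ / 2 + (∑ e, r e) / γ₂ / 2 + (∑ e, r e * B e ^ 2) / 2) * ∫ z, f z ∂gaussianFieldOfKernel K₁ ∧
      Real.exp (-((∑ e, r e) / γ₁ / 2 + (∑ e, r e) / γ₂ / 2 + (∑ e, r e * B e ^ 2) / 2)) * ∫ z, f z ∂gaussianFieldOfKernel K₁ ≤
        ∫ z, f z ∂gaussianFieldOfKernel K₂ := by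
  set E : ℝ := (∑ e, r e) / γ₁ / 2 + (∑ e, r e) / γ₂ / 2 + (∑ e, r e * B e ^ 2) / 2 with hE
  have hr0 : ∀ e, 0 ≤ r e := fun e => le_trans (Finset.sum_nonneg fun _ _ => abs_nonneg _) (hr e)
  have hS0 : 0 ≤ ∑ e, r e := Finset.sum_nonneg fun e _ => hr0 e
  have hE₁ : (∑ e, r e) / γ₁ / 2 + (∑ e, r e * B e ^ 2) / 2 ≤ E := by
    have : 0 ≤ (∑ e, r e) / γ₂ / 2 := by positivity
    linarith
  have hE₂ : -E ≤ -((∑ e, r e) / γ₂ / 2 + (∑ e, r e * B e ^ 2) / 2) := by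
    have : 0 ≤ (∑ e, r e) / γ₁ / 2 := by positivity
    linarith
  have hF : Measurable fun z => ENNReal.ofReal (f z) := ENNReal.measurable_ofReal.comp hf
  have hsuppF : ∀ z, ENNReal.ofReal (f z) ≠ 0 → ∀ e : Λ, |z e| ≤ B e := fun z hz =>
    hsupp z fun h => hz (by rw [h, ENNReal.ofReal_zero])
  obtain ⟨hup', hlow'⟩ := lintegral_bounds_of_rows₂ hK₁ hK₂ hA₁ hA₂ hγ₁0 hγ₂0 r hγ₁ hγ₂ hr B hF hsuppF
  set L₁ := ∫⁻ z, ENNReal.ofReal (f z) ∂gaussianFieldOfKernel K₁ with hL₁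
  set L₂ := ∫⁻ z, ENNReal.ofReal (f z) ∂gaussianFieldOfKernel K₂ with hL₂
  -- weaken both one-sided exponents to the common `E`
  have hup : L₂ ≤ ENNReal.ofReal (Real.exp E) * L₁ :=
    hup'.trans (mul_le_mul' (ENNReal.ofReal_le_ofReal (Real.exp_le_exp.2 hE₁)) le_rfl)
  have hlow : ENNReal.ofReal (Real.exp (-E)) * L₁ ≤ L₂ :=
    le_trans (mul_le_mul' (ENNReal.ofReal_le_ofReal (Real.exp_le_exp.2 hE₂)) le_rfl) hlow'
  have h1 : ∫ z, f z ∂gaussianFieldOfKernel K₁ = L₁.toReal :=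
    integral_eq_lintegral_of_nonneg_ae (Filter.Eventually.of_forall hf0) hf.aestronglyMeasurable
  have h2 : ∫ z, f z ∂gaussianFieldOfKernel K₂ = L₂.toReal :=
    integral_eq_lintegral_of_nonneg_ae (Filter.Eventually.of_forall hf0) hf.aestronglyMeasurable
  rw [h1, h2]
  by_cases htop : L₁ = ∞
  · have h2top : L₂ = ∞ := by
      refine eq_top_iff.mpr (le_trans ?_ hlow)
      rw [htop, ENNReal.mul_top (ENNReal.ofReal_pos.2 (Real.exp_pos _)).ne']
    rw [htop, h2top, ENNReal.toReal_top, mul_zero, mul_zero]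
    exact ⟨le_refl _, le_refl _⟩
  · have h2ne : L₂ ≠ ∞ := ne_top_of_le_ne_top (ENNReal.mul_ne_top ENNReal.ofReal_ne_top htop) hup
    constructor
    · calc L₂.toReal ≤ (ENNReal.ofReal (Real.exp E) * L₁).toReal := ENNReal.toReal_mono (ENNReal.mul_ne_top ENNReal.ofReal_ne_top htop) hup
        _ = Real.exp E * L₁.toReal := by rw [ENNReal.toReal_mul, ENNReal.toReal_ofReal (Real.exp_pos _).le]
    · calc Real.exp (-E) * L₁.toReal = (ENNReal.ofReal (Real.exp (-E)) * L₁).toReal := by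
            rw [ENNReal.toReal_mul, ENNReal.toReal_ofReal (Real.exp_pos _).le]
        _ ≤ L₂.toReal := ENNReal.toReal_mono h2ne hlow

/-- ★★★ **THE CUT-OFF EXPONENTIAL MOMENT OF TWO MEMBERS, two coercivities** (the seam edition: `r_e` may be of order one on the sites where the two
precisions differ, provided each member is elliptic on its own): for every `s, D, ϰ, 𝔄, J, I, b`,
`e^{−E}·∫Πχ̂^I_b e^{H_J} d𝒩(0,K₁) ≤ ∫Πχ̂^I_b e^{H_J} d𝒩(0,K₂) ≤ e^{E}·∫Πχ̂^I_b e^{H_J} d𝒩(0,K₁)`,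
`E = Σ_e r_e/(2γ₁) + Σ_e r_e/(2γ₂) + (b²/2)·Σ_{e∈Λ} r_e(1 + d(I,Δ_e))²`.
[cite: BenfattoEtAl1978, (4.6)–(4.7) p.152 with (A.1) p.161, (5.13) p.155; Balaban1985BackgroundPropagators, Sect. E p.428 (class form; ours)] -/
theorem integral_cutoffBoltzmann_bounds_of_rows₂ (hA₁ : ∀ e e', A₁ e e' = A₁ e' e) (hA₂ : ∀ e e', A₂ e e' = A₂ e' e) {γ₁ γ₂ : ℝ}
    (hγ₁0 : 0 < γ₁) (hγ₂0 : 0 < γ₂) (r : Λ → ℝ) (hγ₁ : ∀ x : Λ → ℝ, γ₁ * ∑ e, x e ^ 2 ≤ ∑ e, ∑ e', A₁ e e' * x e * x e')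
    (hγ₂ : ∀ x : Λ → ℝ, γ₂ * ∑ e, x e ^ 2 ≤ ∑ e, ∑ e', A₂ e e' * x e * x e')
    (hr : ∀ e, ∑ e', |A₂ e e' - A₁ e e'| ≤ r e)
    (s D : ℕ) (ϰ : ℝ) (a : Coef d) (I J : Finset (B1Eq324BenfattoLemma.Site d)) (b : ℝ) :
    ∫ z, cutoffBoltzmann (hamiltonian s D ϰ a J) I b z ∂gaussianFieldOfKernel K₂ ≤
        Real.exp ((∑ e, r e) / γ₁ / 2 + (∑ e, r e) / γ₂ / 2 + (∑ e, r e * (b * (1 + distToRegion I e)) ^ 2) / 2) *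
          ∫ z, cutoffBoltzmann (hamiltonian s D ϰ a J) I b z ∂gaussianFieldOfKernel K₁ ∧
      Real.exp (-((∑ e, r e) / γ₁ / 2 + (∑ e, r e) / γ₂ / 2 + (∑ e, r e * (b * (1 + distToRegion I e)) ^ 2) / 2)) *
          ∫ z, cutoffBoltzmann (hamiltonian s D ϰ a J) I b z ∂gaussianFieldOfKernel K₁ ≤
        ∫ z, cutoffBoltzmann (hamiltonian s D ϰ a J) I b z ∂gaussianFieldOfKernel K₂ := by
  refine integral_bounds_of_rows₂ hK₁ hK₂ hA₁ hA₂ hγ₁0 hγ₂0 r hγ₁ hγ₂ hr (fun e : Λ => b * (1 + distToRegion I e))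
    (measurable_cutoffBoltzmann_hamiltonian a J I b) (fun z => ?_) (fun z hz e => ?_)
  · unfold cutoffBoltzmann
    exact Set.indicator_nonneg (fun _ _ => (Real.exp_pos _).le) z
  · have hmem : z ∈ smallFieldSet I b := by
      by_contra h
      exact hz (by rw [cutoffBoltzmann, Set.indicator_of_notMem h])
    exact hmem e

/-- **The factor form, two coercivities**: `∃ w ∈ [e^{−E}, e^{E}]`, `∫Πχ̂e^{H_J}d𝒩(0,K₂) = (∫Πχ̂e^{H_J}d𝒩(0,K₁))·w`, `E` as in
`integral_cutoffBoltzmann_bounds_of_rows₂`. [cite: BenfattoEtAl1978, (4.6)–(4.7) p.152, (5.13) p.155 (class form; ours)] -/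
theorem exists_factor_integral_cutoffBoltzmann_of_rows₂ (hA₁ : ∀ e e', A₁ e e' = A₁ e' e) (hA₂ : ∀ e e', A₂ e e' = A₂ e' e) {γ₁ γ₂ : ℝ}
    (hγ₁0 : 0 < γ₁) (hγ₂0 : 0 < γ₂) (r : Λ → ℝ) (hγ₁ : ∀ x : Λ → ℝ, γ₁ * ∑ e, x e ^ 2 ≤ ∑ e, ∑ e', A₁ e e' * x e * x e')
    (hγ₂ : ∀ x : Λ → ℝ, γ₂ * ∑ e, x e ^ 2 ≤ ∑ e, ∑ e', A₂ e e' * x e * x e')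
    (hr : ∀ e, ∑ e', |A₂ e e' - A₁ e e'| ≤ r e)
    (s D : ℕ) (ϰ : ℝ) (a : Coef d) (I J : Finset (B1Eq324BenfattoLemma.Site d)) (b : ℝ) :
    ∃ w : ℝ, Real.exp (-((∑ e, r e) / γ₁ / 2 + (∑ e, r e) / γ₂ / 2 + (∑ e, r e * (b * (1 + distToRegion I e)) ^ 2) / 2)) ≤ w ∧
      w ≤ Real.exp ((∑ e, r e) / γ₁ / 2 + (∑ e, r e) / γ₂ / 2 + (∑ e, r e * (b * (1 + distToRegion I e)) ^ 2) / 2) ∧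
      ∫ z, cutoffBoltzmann (hamiltonian s D ϰ a J) I b z ∂gaussianFieldOfKernel K₂ =
        (∫ z, cutoffBoltzmann (hamiltonian s D ϰ a J) I b z ∂gaussianFieldOfKernel K₁) * w := by
  set E : ℝ := (∑ e, r e) / γ₁ / 2 + (∑ e, r e) / γ₂ / 2 + (∑ e, r e * (b * (1 + distToRegion I e)) ^ 2) / 2 with hE
  obtain ⟨hup, hlow⟩ := integral_cutoffBoltzmann_bounds_of_rows₂ hK₁ hK₂ hA₁ hA₂ hγ₁0 hγ₂0 r hγ₁ hγ₂ hr s D ϰ a I J b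
  set Z₁ := ∫ z, cutoffBoltzmann (hamiltonian s D ϰ a J) I b z ∂gaussianFieldOfKernel K₁ with hZ₁
  set Z₂ := ∫ z, cutoffBoltzmann (hamiltonian s D ϰ a J) I b z ∂gaussianFieldOfKernel K₂ with hZ₂
  have hZ₁0 : 0 ≤ Z₁ := integral_nonneg fun z => by
    unfold cutoffBoltzmann
    exact Set.indicator_nonneg (fun _ _ => (Real.exp_pos _).le) z
  have hle : Real.exp (-E) ≤ Real.exp E := Real.exp_le_exp.2 (by
    have : 0 ≤ E := by
      have hr0 : ∀ e, 0 ≤ r e := fun e => le_trans (Finset.sum_nonneg fun _ _ => abs_nonneg _) (hr e)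
      rw [hE]
      exact add_nonneg (add_nonneg (div_nonneg (div_nonneg (Finset.sum_nonneg fun e _ => hr0 e) hγ₁0.le) zero_le_two)
        (div_nonneg (div_nonneg (Finset.sum_nonneg fun e _ => hr0 e) hγ₂0.le) zero_le_two))
        (div_nonneg (Finset.sum_nonneg fun e _ => mul_nonneg (hr0 e) (sq_nonneg _)) zero_le_two)
    linarith)
  rcases eq_or_lt_of_le hZ₁0 with hz | hz
  · refine ⟨Real.exp E, hle, le_rfl, ?_⟩
    have hZ₂0 : Z₂ ≤ 0 := by rw [← hz, mul_zero] at hup; exact hup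
    have hZ₂0' : 0 ≤ Z₂ := by
      have := hlow; rw [← hz, mul_zero] at this; exact this
    rw [← hz, zero_mul]
    exact le_antisymm hZ₂0 hZ₂0'
  · refine ⟨Z₂ / Z₁, ?_, ?_, ?_⟩
    · rw [le_div_iff₀ hz]; exact hlow
    · rw [div_le_iff₀ hz]; exact hup
    · rw [mul_div_cancel₀ _ hz.ne']

end FieldBothCoercive

end Literature.MathematicalPhysics.QuantumFieldTheory.Balaban1983to89.B1Eq324BenfattoKernelComparisonTwoMembers
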